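import Literature.MathematicalPhysics.QuantumFieldTheory.Balaban1983to89.B9SectBStepFrameV3
import Literature.MathematicalPhysics.QuantumFieldTheory.Balaban1983to89.B9SectBL2StepAtLettersV2Second

/-!
# `Balaban1983to89.B9SectBStepFrameV4` — THE LETTERS-LEVEL SECT.-B STEP FRAME, VERSION 4: `SectBFrame₄` + ★★ `sectBStepPrinted_of_sectBFrame₄`;
# = `SectBFrame₃` (p506914) with the LAST TWO (3.46) member-steps of G′(U′U) (n = 3 `‖h∇_U∇_UG′λ‖`, n = 5 `‖hG′∇*_U∇*_Uλ‖`) no longer DISPLAYED but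
# FRAMED KERNEL-FREE by the ℓ²-block route (`B9SectBL2StepAtLettersV2Second`); ALL SIX G′ member-steps are now theorems on the letters — only the
# nine G-side member-steps (Theorem 3.3's operator) remain displayed

T. Bałaban, *Propagators for lattice gauge theories in a background field*, Commun. Math. Phys. **99** (1985) 389–434
[`Balaban1985BackgroundPropagators`, "B9"], Sect. B pp. 400–407 (Theorem 3.4).

statement-level skeleton of published theorems with citation tags; proofs where landed; nothing here is a claim about the Yang–Mills mass gap

WHY (pub-ymgap N06 row 13, seat dag-n06-c g5).  `B9SectBStepFrameV2.SectBFrame₂` framed the ten kernel-free Sect.-B steps and DISPLAYED fifteen member-steps;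
`B9SectBStepFrameV3.SectBFrame₃` framed four of the six G′ ones ((3.46)₀,₁,₂,₄ of G′(U′U)) on print's own inputs.  `B9SectBL2StepAtLettersV2Second` has
since framed the two second-order one-sided members (n = 3 by (3.65)₂ and the ℓ²-summed walk for the left letter ∇_k∇_l; n = 5 by (3.65)₁ and the
left-routed walk for the right letter ∇♯_k∇♯_l — both with the constant weight, p. 398's prefactor `1`).  `SectBFrame₄` merges their readings ∕ writings
into the dictionary; `SectBFrame₄.stepL2Gp` assembles the six G′ member-steps as THEOREMS; `SectBFrame₄.toSectBFrame₃` shows v4 ⇒ v3; and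
`sectBStepPrinted_of_sectBFrame₄` is the v3 capstone verbatim otherwise.

WHAT IS IN THE FILE (0 sorry; standard axioms): `structure SectBFrame₄ … extends GlobGFrame₂, AnGFrame₂, GlobFrame₂, H1Frame₂, E4H2Frame₂, AnFrame₂, L2Frame₂`
(+ fields `readL2_2 writeL2_2 readL2_3 writeL2_3 readL2_4 writeL2_4 readL2_5 writeL2_5`, displayed `stepL2G stepH1G stepE4G stepH2G`); `SectBFrame₄.stepL2Gp`
(∀ n : Fin 6 — six theorems); `SectBFrame₄.toSectBFrame₃`; ★★ `sectBStepPrinted_of_sectBFrame₄ (F) (Sg) (h32) (h33) : B9.SectBStepPrinted F.dB c35 geo bg Gp GA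
Cinv IsAnalyticExt`.

HONEST SCOPE.  Hypothesis structure; NOT shown inhabited; the displayed G-side steps are print's statement (Theorem 3.3 × Theorem 3.4, p. 407), not a
proof; count-neutral; NOT a node discharge; nothing continuum ∕ OS ∕ mass-gap ∕ Clay.  Cell `pub-ymgap` (HUMAN RULING D-0062), Track A node N06 [B9],
N06-ASSIGNMENT row 13, seat `pub-ymgap-dag-n06-c` (g5), 2026-08-27.
-/

noncomputable section

namespace Literature.MathematicalPhysics.QuantumFieldTheory.Balaban1983to89.B9SectBStepFrameV4

open Literature.MathematicalPhysics.QuantumFieldTheory.Balaban1983to89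
open Literature.MathematicalPhysics.QuantumFieldTheory.Balaban1983to89.B6RandomWalkL2 (HasL2Majorant)
open Literature.MathematicalPhysics.QuantumFieldTheory.Balaban1983to89.B9Thm34Ext (toB6)
open Literature.MathematicalPhysics.QuantumFieldTheory.Balaban1983to89.B9Eq352DivFormLetters (conj)
open Literature.MathematicalPhysics.QuantumFieldTheory.Balaban1983to89.B9Eq352GradLetters (diffLetter)
open Literature.MathematicalPhysics.QuantumFieldTheory.Balaban1983to89.B9FromB6 (L2Block)
open Literature.MathematicalPhysics.QuantumFieldTheory.Balaban1983to89.B9SectBStepWhole (StepL2nPos StepH1Pos StepE4Pos StepH2Pos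
  sectBStepPrinted_of_posBlockSteps stepL2Pos_of_members stepAnalyticPos_of_halves)
open Literature.MathematicalPhysics.QuantumFieldTheory.Balaban1983to89.B9SectBGpStepAtLettersV2 (GpFrame₂ CinvFrame₂ GlobFrame₂
  H1Frame₂ E4H2Frame₂ AnFrame₂ stepEPos_of_gpFrame₂ stepKerPos_of_cinvFrame₂ stepGlobPos_of_globFrame₂ stepH1Pos_of_h1Frame₂
  stepE4Pos_of_e4h2Frame₂ stepH2Pos_of_e4h2Frame₂ stepAnalyticPos1_of_anFrame₂)
open Literature.MathematicalPhysics.QuantumFieldTheory.Balaban1983to89.B9SectBGStepAtLettersV2 (GFrame₂ GlobGFrame₂ AnGFrame₂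
  stepEPos_of_gFrame₂ stepGlobPos_of_globGFrame₂ stepAnalyticPos1_of_anGFrame₂)
open Literature.MathematicalPhysics.QuantumFieldTheory.Balaban1983to89.B9SectBL2StepAtLettersV2 (L2Frame₂ stepL2nPos_zero_of_l2Frame₂
  stepL2nPos_one_of_l2Frame₂)
open Literature.MathematicalPhysics.QuantumFieldTheory.Balaban1983to89.B9SectBL2StepAtLettersV2Right (stepL2nPos_two_of_l2Frame₂)
open Literature.MathematicalPhysics.QuantumFieldTheory.Balaban1983to89.B9SectBL2StepAtLettersV2Mixed (stepL2nPos_four_of_l2Frame₂)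
open Literature.MathematicalPhysics.QuantumFieldTheory.Balaban1983to89.B9SectBL2StepAtLettersV2Second (stepL2nPos_three_of_l2Frame₂
  stepL2nPos_five_of_l2Frame₂)
open Literature.MathematicalPhysics.QuantumFieldTheory.Balaban1983to89.B9SectBStepFrameV3 (SectBFrame₃ sectBStepPrinted_of_sectBFrame₃)

universe u

variable {I : Type} (c35 : ℝ) (geo : I → B9.Geometry) (bg : I → B9.Backgrounds)
  (Gp : ∀ i, B9.KernelFamily (geo i) (bg i))
  {𝔸 : Type u} [NormedRing 𝔸] [NormedAlgebra ℂ 𝔸] [CompleteSpace 𝔸] {ι : Type} [Fintype ι] [DecidableEq ι]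
  (b : Module.Basis ι ℝ 𝔸) (κ : Type) [Fintype κ] [LinearOrder κ]
  (S : I → Type) [∀ i, Fintype (S i)] [∀ i, DecidableEq (S i)]
  [∀ i, Fintype (geo i).Site] [∀ i, DecidableEq (geo i).Site] [∀ i, Nonempty (geo i).Site]

/-- **THE WHOLE SECT.-B LETTERS DICTIONARY, V4** — `SectBFrame₂`'s ten kernel-free steps PLUS the `L²` letters dictionary `L2Frame₂` (members 0, 1 of
(3.46) for G′(U′U)) and the readings∕writings of members 2, 3, 4, 5 (`readL2_n`, `writeL2_n`; pure unfolding of the instance's own `KernelFamily.l2`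
against block-ℓ² majorants of its letters: member 2 = `G′∇♯_k` (weight Lʲη), member 3 = `∇_k∇_lG′` (weight 1), member 4 = `∇_kG′∇♯_l` (weight 1),
member 5 = `G′∇♯_k∇♯_l` (weight 1)), with ONLY the NINE G-side positive-input block-steps still DISPLAYED verbatim: the six (3.46) members of G(U′U)
(`stepL2G`), and (3.43) ∕ (3.44) ∕ (3.45) of G(U′U).  A hypothesis structure; nothing asserted.
[cite: Balaban1985BackgroundPropagators, Thm 3.4 p.400 + Sect. B pp.400–407 + Thm 3.1 (3.43)–(3.46) p.398 + Thm 3.3 p.399 + p.403 l.1–9 + p.407] -/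
structure SectBFrame₄ (GA : ∀ i, B9.KernelFamily (geo i) (bg i)) (Cinv : ∀ i, B9.SiteKernel (geo i) (bg i))
    (IsAnalyticExt : ∀ i, B9.KernelFamily (geo i) (bg i) → (bg i).Cfg → ℝ → Prop)
    extends GlobGFrame₂ c35 geo bg Gp b κ S GA Cinv, AnGFrame₂ c35 geo bg Gp b κ S GA Cinv IsAnalyticExt,
      GlobFrame₂ c35 geo bg Gp b κ S, H1Frame₂ c35 geo bg Gp b κ S, E4H2Frame₂ c35 geo bg Gp b κ S,
      AnFrame₂ c35 geo bg Gp b κ S IsAnalyticExt, L2Frame₂ c35 geo bg Gp b κ S where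
  /-- READING (3.46)₂ at U per concrete difference letter (reading constant `cL`). -/
  readL2_2 : ∀ i (α₀ : ℝ) (U : (bg i).Cfg) (B₀ δ : ℝ), MInv ≤ (geo i).M → 0 < α₀ → (geo i).M * α₀ ≤ aInv →
    (bg i).Reg335 c35 α₀ U → 0 < B₀ → 0 < δ → L2Block (Gp i) B₀ δ U →
    ∀ k : κ ⊕ κ, HasL2Majorant (g := toB6 (geo i) (Rr i) (Hp i)) (fun p : S i × ι => blk i p.1)
      (Gop i U * conj b (diffLetter (T i) (coord i U) ((((geo i).eta : ℂ))⁻¹) k))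
      (fun a a' => cL * B₀ * (geo i).len a * Real.exp (-(δ * (geo i).dist a a')))
  /-- WRITING (3.46)₂ at U′U from block-ℓ² majorants of every `G′(U′U)∇♯_k` (letters at the real U). -/
  writeL2_2 : ∀ i (U U' : (bg i).Cfg) (α₁ B δ : ℝ), 0 < α₁ → α₁ ≤ aW → (bg i).Cplx337 α₁ U U' → 0 ≤ B → 0 < δ →
    (∀ k : κ ⊕ κ, HasL2Majorant (g := toB6 (geo i) (Rr i) (Hp i)) (fun p : S i × ι => blk i p.1)
        (Gop i ((bg i).mul U' U) * conj b (diffLetter (T i) (coord i U) ((((geo i).eta : ℂ))⁻¹) k))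
        (fun a a' => B * (geo i).len a * Real.exp (-(δ * (geo i).dist a a')))) →
    ∀ (lam : (geo i).Loc) (h : (geo i).Cut) (y y' : (geo i).Site), (geo i).cutIn h y → (geo i).suppIn lam y' →
      (Gp i).l2 2 ((bg i).mul U' U) lam h ≤
        wL B δ * B9.pref6 ((geo i).len y) 2 * (geo i).cutSup h * Real.exp (-(wLδ δ * (geo i).dist y y')) * (geo i).l2Norm lam
  /-- READING (3.46)₃ at U per PAIR of concrete difference letters: `∇_k∇_lG′(U) ≺₂ cL·B₀·1·e^{−δd}`. -/
  readL2_3 : ∀ i (α₀ : ℝ) (U : (bg i).Cfg) (B₀ δ : ℝ), MInv ≤ (geo i).M → 0 < α₀ → (geo i).M * α₀ ≤ aInv →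
    (bg i).Reg335 c35 α₀ U → 0 < B₀ → 0 < δ → L2Block (Gp i) B₀ δ U →
    ∀ k l : κ ⊕ κ, HasL2Majorant (g := toB6 (geo i) (Rr i) (Hp i)) (fun p : S i × ι => blk i p.1)
      (conj b (diffLetter (T i) (coord i U) ((((geo i).eta : ℂ))⁻¹) k) *
        conj b (diffLetter (T i) (coord i U) ((((geo i).eta : ℂ))⁻¹) l) * Gop i U)
      (fun a a' => cL * B₀ * 1 * Real.exp (-(δ * (geo i).dist a a')))
  /-- WRITING (3.46)₃ at U′U from block-ℓ² majorants of every `∇_k∇_lG′(U′U)` (letters at the real U). -/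
  writeL2_3 : ∀ i (U U' : (bg i).Cfg) (α₁ B δ : ℝ), 0 < α₁ → α₁ ≤ aW → (bg i).Cplx337 α₁ U U' → 0 ≤ B → 0 < δ →
    (∀ k l : κ ⊕ κ, HasL2Majorant (g := toB6 (geo i) (Rr i) (Hp i)) (fun p : S i × ι => blk i p.1)
        (conj b (diffLetter (T i) (coord i U) ((((geo i).eta : ℂ))⁻¹) k) *
          conj b (diffLetter (T i) (coord i U) ((((geo i).eta : ℂ))⁻¹) l) * Gop i ((bg i).mul U' U))
        (fun a a' => B * 1 * Real.exp (-(δ * (geo i).dist a a')))) →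
    ∀ (lam : (geo i).Loc) (h : (geo i).Cut) (y y' : (geo i).Site), (geo i).cutIn h y → (geo i).suppIn lam y' →
      (Gp i).l2 3 ((bg i).mul U' U) lam h ≤
        wL B δ * B9.pref6 ((geo i).len y) 3 * (geo i).cutSup h * Real.exp (-(wLδ δ * (geo i).dist y y')) * (geo i).l2Norm lam
  /-- READING of the mixed member (3.46)₄ at U per pair of concrete difference letters. -/
  readL2_4 : ∀ i (α₀ : ℝ) (U : (bg i).Cfg) (B₀ δ : ℝ), MInv ≤ (geo i).M → 0 < α₀ → (geo i).M * α₀ ≤ aInv →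
    (bg i).Reg335 c35 α₀ U → 0 < B₀ → 0 < δ → L2Block (Gp i) B₀ δ U →
    ∀ k l : κ ⊕ κ, HasL2Majorant (g := toB6 (geo i) (Rr i) (Hp i)) (fun p : S i × ι => blk i p.1)
      (conj b (diffLetter (T i) (coord i U) ((((geo i).eta : ℂ))⁻¹) k) * Gop i U *
        conj b (diffLetter (T i) (coord i U) ((((geo i).eta : ℂ))⁻¹) l))
      (fun a a' => cL * B₀ * 1 * Real.exp (-(δ * (geo i).dist a a')))
  /-- WRITING of the mixed member (3.46)₄ at U′U from block-ℓ² majorants of every `∇_kG′(U′U)∇♯_l`. -/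
  writeL2_4 : ∀ i (U U' : (bg i).Cfg) (α₁ B δ : ℝ), 0 < α₁ → α₁ ≤ aW → (bg i).Cplx337 α₁ U U' → 0 ≤ B → 0 < δ →
    (∀ k l : κ ⊕ κ, HasL2Majorant (g := toB6 (geo i) (Rr i) (Hp i)) (fun p : S i × ι => blk i p.1)
        (conj b (diffLetter (T i) (coord i U) ((((geo i).eta : ℂ))⁻¹) k) * Gop i ((bg i).mul U' U) *
          conj b (diffLetter (T i) (coord i U) ((((geo i).eta : ℂ))⁻¹) l))
        (fun a a' => B * 1 * Real.exp (-(δ * (geo i).dist a a')))) →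
    ∀ (lam : (geo i).Loc) (h : (geo i).Cut) (y y' : (geo i).Site), (geo i).cutIn h y → (geo i).suppIn lam y' →
      (Gp i).l2 4 ((bg i).mul U' U) lam h ≤
        wL B δ * B9.pref6 ((geo i).len y) 4 * (geo i).cutSup h * Real.exp (-(wLδ δ * (geo i).dist y y')) * (geo i).l2Norm lam
  /-- READING (3.46)₅ at U per PAIR of concrete difference letters: `G′(U)∇♯_k∇♯_l ≺₂ cL·B₀·1·e^{−δd}`. -/
  readL2_5 : ∀ i (α₀ : ℝ) (U : (bg i).Cfg) (B₀ δ : ℝ), MInv ≤ (geo i).M → 0 < α₀ → (geo i).M * α₀ ≤ aInv →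
    (bg i).Reg335 c35 α₀ U → 0 < B₀ → 0 < δ → L2Block (Gp i) B₀ δ U →
    ∀ k l : κ ⊕ κ, HasL2Majorant (g := toB6 (geo i) (Rr i) (Hp i)) (fun p : S i × ι => blk i p.1)
      (Gop i U * conj b (diffLetter (T i) (coord i U) ((((geo i).eta : ℂ))⁻¹) k) *
        conj b (diffLetter (T i) (coord i U) ((((geo i).eta : ℂ))⁻¹) l))
      (fun a a' => cL * B₀ * 1 * Real.exp (-(δ * (geo i).dist a a')))
  /-- WRITING (3.46)₅ at U′U from block-ℓ² majorants of every `G′(U′U)∇♯_k∇♯_l` (letters at the real U). -/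
  writeL2_5 : ∀ i (U U' : (bg i).Cfg) (α₁ B δ : ℝ), 0 < α₁ → α₁ ≤ aW → (bg i).Cplx337 α₁ U U' → 0 ≤ B → 0 < δ →
    (∀ k l : κ ⊕ κ, HasL2Majorant (g := toB6 (geo i) (Rr i) (Hp i)) (fun p : S i × ι => blk i p.1)
        (Gop i ((bg i).mul U' U) * conj b (diffLetter (T i) (coord i U) ((((geo i).eta : ℂ))⁻¹) k) *
          conj b (diffLetter (T i) (coord i U) ((((geo i).eta : ℂ))⁻¹) l))
        (fun a a' => B * 1 * Real.exp (-(δ * (geo i).dist a a')))) →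
    ∀ (lam : (geo i).Loc) (h : (geo i).Cut) (y y' : (geo i).Site), (geo i).cutIn h y → (geo i).suppIn lam y' →
      (Gp i).l2 5 ((bg i).mul U' U) lam h ≤
        wL B δ * B9.pref6 ((geo i).len y) 5 * (geo i).cutSup h * Real.exp (-(wLδ δ * (geo i).dist y y')) * (geo i).l2Norm lam
  /-- DISPLAYED (3.46) for G(U′U): the six positive-input L² block-steps, verbatim (p. 407). -/
  stepL2G : ∀ n : Fin 6, StepL2nPos dB c35 geo bg Gp GA Cinv GA n
  /-- DISPLAYED (3.43) for G(U′U) (p. 407). -/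
  stepH1G : StepH1Pos dB c35 geo bg Gp GA Cinv GA
  /-- DISPLAYED (3.44) for G(U′U) (p. 407). -/
  stepE4G : StepE4Pos dB c35 geo bg Gp GA Cinv GA
  /-- DISPLAYED (3.45) for G(U′U) (p. 407). -/
  stepH2G : StepH2Pos dB c35 geo bg Gp GA Cinv GA

variable {c35 geo bg Gp b κ S}

/-- **ALL SIX (3.46) member-steps of G′(U′U) from a `SectBFrame₄` are THEOREMS on the letters** (kernel-free ℓ²-block route): n = 0, 1
(`B9SectBL2StepAtLettersV2`), n = 2 (`…V2Right`), n = 3, 5 (`…V2Second`), n = 4 (`…V2Mixed`).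
[cite: Balaban1985BackgroundPropagators, Thm 3.1 (3.46) p.398 + Thm 3.4 p.400 + p.403 l.1–9] -/
theorem SectBFrame₄.stepL2Gp {GA : ∀ i, B9.KernelFamily (geo i) (bg i)} {Cinv : ∀ i, B9.SiteKernel (geo i) (bg i)}
    {IsAnalyticExt : ∀ i, B9.KernelFamily (geo i) (bg i) → (bg i).Cfg → ℝ → Prop}
    (F : SectBFrame₄ c35 geo bg Gp b κ S GA Cinv IsAnalyticExt) : ∀ n : Fin 6, StepL2nPos F.dB c35 geo bg Gp GA Cinv Gp n := by
  intro n
  fin_cases n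
  · exact stepL2nPos_zero_of_l2Frame₂ F.toL2Frame₂ GA Cinv
  · exact stepL2nPos_one_of_l2Frame₂ F.toL2Frame₂ GA Cinv
  · exact stepL2nPos_two_of_l2Frame₂ F.toL2Frame₂ F.readL2_2 F.writeL2_2 GA Cinv
  · exact stepL2nPos_three_of_l2Frame₂ F.toL2Frame₂ F.readL2_3 F.writeL2_3 GA Cinv
  · exact stepL2nPos_four_of_l2Frame₂ F.toL2Frame₂ F.readL2_2 F.readL2_4 F.writeL2_4 GA Cinv
  · exact stepL2nPos_five_of_l2Frame₂ F.toL2Frame₂ F.readL2_2 F.readL2_5 F.writeL2_5 GA Cinv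

/-- **v4 ⇒ v3**: a `SectBFrame₄` yields a `SectBFrame₃` whose two displayed G′ member-steps (n = 3, 5) are filled by the theorems of
`B9SectBL2StepAtLettersV2Second`. [cite: Balaban1985BackgroundPropagators, Thm 3.1 (3.46) p.398 + Thm 3.4 p.400 + p.403 l.1–9] -/
def SectBFrame₄.toSectBFrame₃ {GA : ∀ i, B9.KernelFamily (geo i) (bg i)} {Cinv : ∀ i, B9.SiteKernel (geo i) (bg i)}
    {IsAnalyticExt : ∀ i, B9.KernelFamily (geo i) (bg i) → (bg i).Cfg → ℝ → Prop}
    (F : SectBFrame₄ c35 geo bg Gp b κ S GA Cinv IsAnalyticExt) : SectBFrame₃ c35 geo bg Gp b κ S GA Cinv IsAnalyticExt :=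
  { F with stepL2Gp3 := F.stepL2Gp 3, stepL2Gp5 := F.stepL2Gp 5 }

/-- ★★ **ROW 13's `hB` IN ONE INSTANTIATION (v4)**: every `SectBFrame₄`, with the model signs of the readings and Theorems 3.2 ∕ 3.3 of the leaf, yields
`B9.SectBStepPrinted F.dB c35 geo bg Gp GA Cinv IsAnalyticExt` — as `B9SectBStepFrameV3.sectBStepPrinted_of_sectBFrame₃`, with ALL six (3.46) member-steps of
G′(U′U) now theorems (`SectBFrame₄.stepL2Gp`).  Honest scope: the frame is NOT shown inhabited; nothing of Sect. B is asserted beyond what the tree's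
theorems prove; the displayed G-side steps are print's statement, not a proof.
[cite: Balaban1985BackgroundPropagators, Thm 3.4 p.400 + Sect. B pp.400–407 + Thms 3.1–3.3 pp.397–399] -/
theorem sectBStepPrinted_of_sectBFrame₄ {GA : ∀ i, B9.KernelFamily (geo i) (bg i)} {Cinv : ∀ i, B9.SiteKernel (geo i) (bg i)}
    {IsAnalyticExt : ∀ i, B9.KernelFamily (geo i) (bg i) → (bg i).Cfg → ℝ → Prop}
    (F : SectBFrame₄ c35 geo bg Gp b κ S GA Cinv IsAnalyticExt)
    {P : ∀ i, (geo i).Loc → Prop} (Sg : ∀ i, B9FromB6ModelSignsOn.ModelSignsOn (geo i) (P i))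
    (h32 : B9.Thm32Printed F.dB c35 geo bg Cinv) (h33 : B9.Thm33Printed c35 geo bg Gp GA) :
    B9.SectBStepPrinted F.dB c35 geo bg Gp GA Cinv IsAnalyticExt :=
  sectBStepPrinted_of_posBlockSteps Sg h32 h33
    (stepAnalyticPos_of_halves
      (stepAnalyticPos1_of_anFrame₂ F.toAnFrame₂ GA Cinv)
      (stepAnalyticPos1_of_anGFrame₂ F.toAnGFrame₂ F.d261 F.h261))
    (stepEPos_of_gpFrame₂ F.toGpFrame₂ GA Cinv)
    (stepL2Pos_of_members Sg F.stepL2Gp)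
    (stepGlobPos_of_globFrame₂ F.toGlobFrame₂ GA Cinv)
    (stepH1Pos_of_h1Frame₂ F.toH1Frame₂ GA Cinv)
    (stepE4Pos_of_e4h2Frame₂ F.toE4H2Frame₂ GA Cinv)
    (stepH2Pos_of_e4h2Frame₂ F.toE4H2Frame₂ GA Cinv)
    (stepKerPos_of_cinvFrame₂ F.toCinvFrame₂ GA)
    (stepEPos_of_gFrame₂ F.toGFrame₂ F.d261 F.h261)
    (stepL2Pos_of_members Sg F.stepL2G)
    (stepGlobPos_of_globGFrame₂ F.toGlobGFrame₂ F.d261 F.h261) F.stepH1G F.stepE4G F.stepH2G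

end Literature.MathematicalPhysics.QuantumFieldTheory.Balaban1983to89.B9SectBStepFrameV4
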